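import Literature.NumberTheory.LFunctions.MellinPlancherel
import Literature.NumberTheory.LFunctions.PowerOscillatoryIntegrals
import HarnessLib

/-!
# Mellin–Plancherel for logarithmic Riesz means

Support file (everything PROVED, no definitions, no named facts) for the Montgomery–Vaughan
logarithmic mean value theorem (`Literature.Barriers.RiemannHypothesis.MontgomeryVaughan2001_zeroFree`).
Companion to `MellinPlancherel.lean`: for coefficients `a : ℕ → ℂ` with `∑ |a_n| n^{-σ} < ∞` and
absolute partial sums `∑_{n ≤ y} |a_n| ≤ C y^θ` (`θ < σ`), the logarithmic Riesz sums
`R(v) = ∑_{n ≤ e^v} a_n (v − log n) = v A(e^v) − B(e^v)` (`A = ∑ a_n`, `B = ∑ a_n log n`) satisfy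

`∫_ℝ |R(v)|² e^{−2σv} dv = (1/2π) ∫_ℝ |L(σ+iy)|² / |σ+iy|⁴ dy`,   `L(s) = ∑ a_n n^{−s}`,

because the Fourier transform of `e^{−σv} R(v)` is `L(s)/s²`, `s = σ + 2πiξ` (each piece
`a_n (v − log n) e^{−σv} 1[v ≥ log n]` transforms to `a_n n^{−s}/s²`, `∫₀^∞ w e^{−sw} dw = 1/s²`).
This is the identity behind Roy–Vatwani 2019, §6.1 (eq:intg2 bound) ("Plancherel's identity" for
`∑_{n ≤ u} (f(n)/n) log(u/n)`), and Montgomery–Vaughan 2007, (5.25).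

## Main results (namespace `Literature.NumberTheory.LFunctions.MellinPlancherel`)
- `rieszPhi_eq_sum` : `e^{−σv}(v A(e^v) − B(e^v)) = ∑_{n ≤ e^v} a_n (v − log n) e^{−σv}`.
- `fourier_rieszPiece`, `fourier_rieszPhi` : the Fourier transforms `a_n n^{−s}/s²`, `L(s)/s²`.
- `integral_norm_sq_riesz_exp` : the displayed Plancherel identity.

## References
- [MontgomeryVaughan2007] H. L. Montgomery, R. C. Vaughan, *Multiplicative Number Theory I*, §5.1.
- [RoyVatwani2019] A. Roy, A. Vatwani, *Zeros of partial sums of L-functions*, §6.1.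
-/

noncomputable section

open MeasureTheory Real Complex Finset Set Filter FourierTransform

namespace Literature.NumberTheory.LFunctions.MellinPlancherel

variable {a : ℕ → ℂ} {σ θ C : ℝ}

/-! ### The pieces `ψ_n(v) = a_n (v − log n) e^{−σv} 1[log n ≤ v]` and the function `Φ` -/

section pieces

variable (a σ)

/-- The hypothesis-free description of the pieces: we work with a family `ψ` together with the
equation `hψ` defining it (no new definition is introduced). [folklore] -/
theorem rieszPiece_apply (ψ : ℕ → ℝ → ℂ)
    (hψ : ∀ n v, ψ n v = if 1 ≤ n then (Set.Ici (Real.log n)).indicator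
      (fun v : ℝ => a n * ((v - Real.log n : ℝ) : ℂ) * (Real.exp (-(σ * v)) : ℂ)) v else 0)
    (n : ℕ) (v : ℝ) :
    ψ n v = if 1 ≤ n ∧ Real.log n ≤ v then a n * ((v - Real.log n : ℝ) : ℂ) * (Real.exp (-(σ * v)) : ℂ)
      else 0 := by
  rw [hψ]
  by_cases hn : 1 ≤ n
  · simp only [hn, if_true, true_and]
    by_cases hu : Real.log n ≤ v
    · rw [Set.indicator_of_mem (by exact hu), if_pos hu]
    · rw [Set.indicator_of_notMem (by exact hu), if_neg hu]
  · simp [hn]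

variable {a σ}

/-- `ψ_n(v) = 0` unless `1 ≤ n ≤ e^v`. [folklore] -/
theorem rieszPiece_eq_zero_of_not_mem (ψ : ℕ → ℝ → ℂ)
    (hψ : ∀ n v, ψ n v = if 1 ≤ n then (Set.Ici (Real.log n)).indicator
      (fun v : ℝ => a n * ((v - Real.log n : ℝ) : ℂ) * (Real.exp (-(σ * v)) : ℂ)) v else 0)
    (v : ℝ) {n : ℕ} (hn : n ∉ Finset.Icc 1 ⌊Real.exp v⌋₊) : ψ n v = 0 := by
  rw [rieszPiece_apply a σ ψ hψ]
  split_ifs with h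
  · exfalso
    apply hn
    rw [Finset.mem_Icc]
    exact ⟨h.1, (le_floor_exp_iff h.1 v).mpr h.2⟩
  · rfl

/-- **The Riesz sum in terms of partial sums**:
`e^{−σv} (v A(e^v) − B(e^v)) = ∑_{n ≤ e^v} ψ_n(v)` with `A = psum a`, `B = psum (a log)`. [folklore] -/
theorem rieszPhi_eq_sum (ψ : ℕ → ℝ → ℂ)
    (hψ : ∀ n v, ψ n v = if 1 ≤ n then (Set.Ici (Real.log n)).indicator
      (fun v : ℝ => a n * ((v - Real.log n : ℝ) : ℂ) * (Real.exp (-(σ * v)) : ℂ)) v else 0) (v : ℝ) :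
    (Real.exp (-(σ * v)) : ℂ) * ((v : ℂ) * psum a (Real.exp v) -
        psum (fun n => a n * (Real.log n : ℂ)) (Real.exp v)) =
      ∑ n ∈ Finset.Icc 1 ⌊Real.exp v⌋₊, ψ n v := by
  unfold psum
  rw [Finset.mul_sum, ← Finset.sum_sub_distrib, Finset.mul_sum]
  refine Finset.sum_congr rfl fun n hn => ?_
  rw [Finset.mem_Icc] at hn
  rw [rieszPiece_apply a σ ψ hψ, if_pos ⟨hn.1, (le_floor_exp_iff hn.1 v).mp hn.2⟩]
  push_cast
  ring

/-- … hence `= ∑' n, ψ_n(v)`. [folklore] -/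
theorem rieszPhi_eq_tsum (ψ : ℕ → ℝ → ℂ)
    (hψ : ∀ n v, ψ n v = if 1 ≤ n then (Set.Ici (Real.log n)).indicator
      (fun v : ℝ => a n * ((v - Real.log n : ℝ) : ℂ) * (Real.exp (-(σ * v)) : ℂ)) v else 0) (v : ℝ) :
    (Real.exp (-(σ * v)) : ℂ) * ((v : ℂ) * psum a (Real.exp v) -
        psum (fun n => a n * (Real.log n : ℂ)) (Real.exp v)) = ∑' n, ψ n v := by
  rw [rieszPhi_eq_sum ψ hψ, tsum_eq_sum]
  intro n hn
  exact rieszPiece_eq_zero_of_not_mem ψ hψ v hn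

/-- The Riesz sum as `∑ a_n (v − log n)`: norm bound by the absolute partial sums,
`‖v A(e^v) − B(e^v)‖ ≤ v ∑_{n ≤ e^v} |a_n|` (both sides vanish for `v < 0`). [folklore] -/
theorem norm_riesz_le (v : ℝ) :
    ‖(v : ℂ) * psum a (Real.exp v) - psum (fun n => a n * (Real.log n : ℂ)) (Real.exp v)‖ ≤
      v * ∑ n ∈ Finset.Icc 1 ⌊Real.exp v⌋₊, ‖a n‖ := by
  unfold psum
  rw [Finset.mul_sum, ← Finset.sum_sub_distrib, Finset.mul_sum]
  refine (norm_sum_le _ _).trans (Finset.sum_le_sum fun n hn => ?_)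
  rw [Finset.mem_Icc] at hn
  have hn1 : (1 : ℝ) ≤ n := by exact_mod_cast hn.1
  have hlog0 : 0 ≤ Real.log n := Real.log_nonneg hn1
  have hlogv : Real.log n ≤ v := (le_floor_exp_iff hn.1 v).mp hn.2
  rw [show (v : ℂ) * a n - a n * (Real.log n : ℂ) = a n * ((v - Real.log n : ℝ) : ℂ) by push_cast; ring,
    norm_mul, Complex.norm_real, Real.norm_eq_abs, abs_of_nonneg (by linarith), mul_comm]
  exact mul_le_mul_of_nonneg_right (by linarith) (norm_nonneg _)

/-! ### Integrals of the pieces -/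

/-- `∫₀^∞ w e^{−σw} dw = 1/σ²` (real `σ > 0`). [folklore] -/
theorem integral_mul_exp_neg_mul_Ioi {σ : ℝ} (hσ : 0 < σ) :
    ∫ w in Set.Ioi (0 : ℝ), w * Real.exp (-(σ * w)) = 1 / σ ^ 2 := by
  have h := Real.integral_rpow_mul_exp_neg_mul_Ioi (a := 2) (r := σ) (by norm_num) hσ
  simp only [show (2 : ℝ) - 1 = 1 by norm_num, Real.rpow_one, Real.Gamma_two, mul_one] at h
  rw [h, Real.rpow_two]
  field_simp

/-- `∫₀^∞ w e^{−sw} dw = 1/s²` (`Re s > 0`). [folklore] -/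
theorem integral_mul_exp_neg_mul_Ioi_complex {s : ℂ} (hs : 0 < s.re) :
    ∫ w in Set.Ioi (0 : ℝ), (w : ℂ) * Complex.exp (-(s * w)) = 1 / s ^ 2 := by
  have h := Literature.NumberTheory.LFunctions.AFE.integral_cpow_mul_exp_neg_mul_Ioi_complex
    (a := 2) (r := s) (by norm_num) hs
  have hG : Complex.Gamma 2 = 1 := by
    rw [show (2 : ℂ) = 1 + 1 by norm_num, Complex.Gamma_add_one _ one_ne_zero, Complex.Gamma_one, mul_one]
  simp only [show (2 : ℂ) - 1 = 1 by norm_num, Complex.cpow_one, hG, mul_one, Complex.cpow_ofNat] at h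
  rw [h]
  have hs0 : s ≠ 0 := by rintro rfl; simp at hs
  field_simp

/-- `∫ ‖ψ_n‖ = ‖a_n‖ n^{−σ}/σ²` (`n ≥ 1`), `0` for `n = 0`. [folklore] -/
theorem integral_norm_rieszPiece (hσ : 0 < σ) (ψ : ℕ → ℝ → ℂ)
    (hψ : ∀ n v, ψ n v = if 1 ≤ n then (Set.Ici (Real.log n)).indicator
      (fun v : ℝ => a n * ((v - Real.log n : ℝ) : ℂ) * (Real.exp (-(σ * v)) : ℂ)) v else 0) (n : ℕ) :
    ∫ v, ‖ψ n v‖ = if 1 ≤ n then ‖a n‖ * ((n : ℝ) ^ σ)⁻¹ / σ ^ 2 else 0 := by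
  by_cases hn : 1 ≤ n
  · simp only [hn, if_true]
    have hn0 : (0 : ℝ) < n := by exact_mod_cast hn
    -- the norm of the piece as an indicator
    have hnorm : (fun v => ‖ψ n v‖) = (Set.Ici (Real.log n)).indicator
        (fun v => ‖a n‖ * ((v - Real.log n) * Real.exp (-(σ * v)))) := by
      funext v
      rw [hψ]
      simp only [hn, if_true]
      by_cases hu : v ∈ Set.Ici (Real.log n)
      · rw [Set.indicator_of_mem hu, Set.indicator_of_mem hu, norm_mul, norm_mul, Complex.norm_real,
          Complex.norm_real, Real.norm_of_nonneg (Real.exp_pos _).le,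
          Real.norm_of_nonneg (by simpa using hu)]
        ring
      · rw [Set.indicator_of_notMem hu, Set.indicator_of_notMem hu, norm_zero]
    rw [hnorm]
    -- translate by `log n`
    have htr := integral_add_right_eq_self (μ := volume)
      ((Set.Ici (Real.log n)).indicator (fun v => ‖a n‖ * ((v - Real.log n) * Real.exp (-(σ * v))))) (Real.log n)
    rw [← htr]
    have hshift : (fun x : ℝ => (Set.Ici (Real.log n)).indicator
        (fun v => ‖a n‖ * ((v - Real.log n) * Real.exp (-(σ * v)))) (x + Real.log n)) =
        (Set.Ici (0 : ℝ)).indicator (fun w => ‖a n‖ * ((n : ℝ) ^ σ)⁻¹ * (w * Real.exp (-(σ * w)))) := by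
      funext w
      by_cases hw : (0 : ℝ) ≤ w
      · rw [Set.indicator_of_mem (show w + Real.log n ∈ Set.Ici (Real.log n) by simpa using hw),
          Set.indicator_of_mem (by exact hw)]
        rw [add_sub_cancel_right, show -(σ * (w + Real.log n)) = -(σ * w) + (-σ) * Real.log n by ring,
          Real.exp_add, show (-σ) * Real.log n = Real.log n * (-σ) by ring, Real.exp_mul,
          Real.exp_log hn0, Real.rpow_neg hn0.le]
        ring
      · rw [Set.indicator_of_notMem (show w + Real.log n ∉ Set.Ici (Real.log n) by simpa using hw),
          Set.indicator_of_notMem (by exact hw)]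
    rw [hshift, integral_indicator measurableSet_Ici, integral_Ici_eq_integral_Ioi, integral_const_mul,
      integral_mul_exp_neg_mul_Ioi hσ]
    ring
  · simp only [hn, if_false]
    have : (fun v => ‖ψ n v‖) = fun _ => 0 := by funext v; rw [hψ]; simp [hn]
    rw [this, integral_zero]

/-- Each piece is integrable. [folklore] -/
theorem integrable_rieszPiece (hσ : 0 < σ) (ψ : ℕ → ℝ → ℂ)
    (hψ : ∀ n v, ψ n v = if 1 ≤ n then (Set.Ici (Real.log n)).indicator
      (fun v : ℝ => a n * ((v - Real.log n : ℝ) : ℂ) * (Real.exp (-(σ * v)) : ℂ)) v else 0) (n : ℕ) :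
    Integrable (ψ n) := by
  have hfun : ψ n = fun v => ψ n v := rfl
  by_cases hn : 1 ≤ n
  · have heq : ψ n = (Set.Ici (Real.log n)).indicator
        (fun v : ℝ => a n * ((v - Real.log n : ℝ) : ℂ) * (Real.exp (-(σ * v)) : ℂ)) := by
      funext v; rw [hψ]; simp [hn]
    rw [heq, integrable_indicator_iff measurableSet_Ici, integrableOn_Ici_iff_integrableOn_Ioi]
    -- dominate `(v - log n) e^{-σ v}` by `(2/σ) e^{-(σ/2) v}` on `v > log n`
    have hdom : IntegrableOn (fun v : ℝ => ‖a n‖ * ((2 / σ) * Real.exp (-(σ / 2) * (v - Real.log n)) *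
        Real.exp (-(σ * Real.log n)))) (Set.Ioi (Real.log n)) := by
      have h0 := integrableOn_exp_mul_Ioi (a := -(σ / 2)) (by linarith) (Real.log n)
      have h1 : IntegrableOn (fun v : ℝ => Real.exp (-(σ / 2) * (v - Real.log n))) (Set.Ioi (Real.log n)) := by
        have : (fun v : ℝ => Real.exp (-(σ / 2) * (v - Real.log n))) =
            fun v => Real.exp ((σ / 2) * Real.log n) * Real.exp (-(σ / 2) * v) := by
          funext v; rw [← Real.exp_add]; ring_nf
        rw [this]
        exact h0.const_mul _
      exact IntegrableOn.congr_fun (((h1.const_mul (2 / σ)).mul_const (Real.exp (-(σ * Real.log n)))).const_mul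
        ‖a n‖) (fun v _ => rfl) measurableSet_Ioi
    refine Integrable.mono' hdom ?_ ?_
    · exact (Continuous.aestronglyMeasurable (by fun_prop)).restrict
    · refine (ae_restrict_iff' measurableSet_Ioi).2 (Filter.Eventually.of_forall fun v hv => ?_)
      rw [Set.mem_Ioi] at hv
      have hw : 0 ≤ v - Real.log n := by linarith
      rw [norm_mul, norm_mul, Complex.norm_real, Complex.norm_real, Real.norm_of_nonneg hw,
        Real.norm_of_nonneg (Real.exp_pos _).le, mul_assoc]
      refine mul_le_mul_of_nonneg_left ?_ (norm_nonneg _)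
      -- `w e^{-σ v} ≤ (2/σ) e^{-(σ/2) w} e^{-σ log n}` with `w = v - log n`, `v = w + log n`
      have hexp : Real.exp (-(σ * v)) = Real.exp (-(σ / 2) * (v - Real.log n)) *
          (Real.exp (-(σ / 2) * (v - Real.log n)) * Real.exp (-(σ * Real.log n))) := by
        rw [← Real.exp_add, ← Real.exp_add]; ring_nf
      rw [hexp]
      have hkey : (v - Real.log n) * Real.exp (-(σ / 2) * (v - Real.log n)) ≤ 2 / σ := by
        have h1 : σ / 2 * (v - Real.log n) + 1 ≤ Real.exp (σ / 2 * (v - Real.log n)) := Real.add_one_le_exp _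
        have h2 : Real.exp (-(σ / 2) * (v - Real.log n)) * Real.exp (σ / 2 * (v - Real.log n)) = 1 := by
          rw [← Real.exp_add]; ring_nf; exact Real.exp_zero
        have h3 : 0 < Real.exp (-(σ / 2) * (v - Real.log n)) := Real.exp_pos _
        rw [le_div_iff₀ hσ]
        nlinarith [mul_le_mul_of_nonneg_left h1 h3.le]
      have h4 : 0 ≤ Real.exp (-(σ / 2) * (v - Real.log n)) * Real.exp (-(σ * Real.log n)) := by positivity
      calc (v - Real.log n) * (Real.exp (-(σ / 2) * (v - Real.log n)) *
            (Real.exp (-(σ / 2) * (v - Real.log n)) * Real.exp (-(σ * Real.log n))))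
          = ((v - Real.log n) * Real.exp (-(σ / 2) * (v - Real.log n))) *
              (Real.exp (-(σ / 2) * (v - Real.log n)) * Real.exp (-(σ * Real.log n))) := by ring
        _ ≤ 2 / σ * (Real.exp (-(σ / 2) * (v - Real.log n)) * Real.exp (-(σ * Real.log n))) :=
            mul_le_mul_of_nonneg_right hkey h4
        _ = 2 / σ * Real.exp (-(σ / 2) * (v - Real.log n)) * Real.exp (-(σ * Real.log n)) := by ring
  · have heq : ψ n = fun _ => 0 := by funext v; rw [hψ]; simp [hn]
    rw [heq]
    exact integrable_zero _ _ _

/-- **The Fourier transform of one piece**: for `n ≥ 1` and `s = σ + 2πiξ`,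
`∫ e(−vξ) ψ_n(v) dv = a_n n^{−s}/s²`. [folklore] -/
theorem fourier_rieszPiece (hσ : 0 < σ) (ψ : ℕ → ℝ → ℂ)
    (hψ : ∀ n v, ψ n v = if 1 ≤ n then (Set.Ici (Real.log n)).indicator
      (fun v : ℝ => a n * ((v - Real.log n : ℝ) : ℂ) * (Real.exp (-(σ * v)) : ℂ)) v else 0)
    {n : ℕ} (hn : 1 ≤ n) (ξ : ℝ) :
    ∫ v : ℝ, (Real.fourierChar (-(v * ξ)) : ℂ) • ψ n v =
      LSeries.term a (σ + (2 * π * ξ : ℝ) * I) n / (σ + (2 * π * ξ : ℝ) * I) ^ 2 := by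
  set s : ℂ := σ + (2 * π * ξ : ℝ) * I with hs
  have hsre : s.re = σ := by simp [hs]
  have hs0 : s ≠ 0 := by
    intro h; have := congrArg Complex.re h; rw [hsre] at this; simp at this; linarith
  have hn0' : (0 : ℝ) < n := by exact_mod_cast hn
  have hn0 : (n : ℂ) ≠ 0 := by exact_mod_cast (show n ≠ 0 by omega)
  -- the integrand as an indicator of `a n * (v - log n) * exp (-s v)`
  have hpt : (fun v : ℝ => (Real.fourierChar (-(v * ξ)) : ℂ) • ψ n v) =
      (Set.Ici (Real.log n)).indicator (fun v : ℝ => a n * (((v - Real.log n : ℝ) : ℂ) * Complex.exp (-s * v))) := by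
    funext v
    rw [hψ]
    simp only [hn, if_true]
    by_cases hu : v ∈ Set.Ici (Real.log n)
    · rw [Set.indicator_of_mem hu, Set.indicator_of_mem hu, smul_eq_mul, Real.fourierChar_apply,
        Complex.ofReal_exp]
      rw [show a n * (((v - Real.log n : ℝ) : ℂ) * Complex.exp (-s * v)) =
        a n * ((v - Real.log n : ℝ) : ℂ) * (Complex.exp (↑(2 * π * -(v * ξ)) * I) * Complex.exp (↑(-(σ * v)))) by
        rw [← Complex.exp_add, mul_assoc]; congr 2; simp only [hs]; push_cast; ring]
      ring
    · rw [Set.indicator_of_notMem hu, Set.indicator_of_notMem hu, smul_zero]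
  rw [hpt]
  -- translate by `log n`
  have htr := integral_add_right_eq_self (μ := volume)
    ((Set.Ici (Real.log n)).indicator (fun v : ℝ => a n * (((v - Real.log n : ℝ) : ℂ) * Complex.exp (-s * v))))
    (Real.log n)
  rw [← htr]
  have hshift : (fun x : ℝ => (Set.Ici (Real.log n)).indicator
      (fun v : ℝ => a n * (((v - Real.log n : ℝ) : ℂ) * Complex.exp (-s * v))) (x + Real.log n)) =
      (Set.Ici (0 : ℝ)).indicator (fun w : ℝ => a n * Complex.exp (-s * (Real.log n : ℝ)) *
        ((w : ℂ) * Complex.exp (-(s * w)))) := by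
    funext w
    by_cases hw : (0 : ℝ) ≤ w
    · rw [Set.indicator_of_mem (show w + Real.log n ∈ Set.Ici (Real.log n) by simpa using hw),
        Set.indicator_of_mem (by exact hw), add_sub_cancel_right]
      rw [show -s * ((w + Real.log n : ℝ) : ℂ) = -(s * w) + -s * (Real.log n : ℝ) by push_cast; ring,
        Complex.exp_add]
      ring
    · rw [Set.indicator_of_notMem (show w + Real.log n ∉ Set.Ici (Real.log n) by simpa using hw),
        Set.indicator_of_notMem (by exact hw)]
  rw [hshift, integral_indicator measurableSet_Ici, integral_Ici_eq_integral_Ioi, integral_const_mul,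
    integral_mul_exp_neg_mul_Ioi_complex (by rw [hsre]; exact hσ)]
  -- `exp(-s log n) = n^{-s}`
  have hexp : Complex.exp (-s * (Real.log n : ℝ)) = (n : ℂ) ^ (-s) := by
    rw [Complex.cpow_def_of_ne_zero hn0, ← Complex.ofReal_natCast, ← Complex.ofReal_log (Nat.cast_nonneg n)]
    congr 1; push_cast; ring
  rw [hexp, LSeries.term_of_ne_zero (by omega), Complex.cpow_neg]
  field_simp

end pieces

/-! ### The Fourier transform of `Φ` and Plancherel -/

variable (hσ : 0 < σ) (hsum : Summable fun n : ℕ => ‖a n‖ / (n : ℝ) ^ σ)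
include hσ hsum

/-- `∑_n ∫ |ψ_n| < ∞` when `∑ |a_n| n^{−σ} < ∞`. [folklore] -/
theorem summable_integral_norm_rieszPiece (ψ : ℕ → ℝ → ℂ)
    (hψ : ∀ n v, ψ n v = if 1 ≤ n then (Set.Ici (Real.log n)).indicator
      (fun v : ℝ => a n * ((v - Real.log n : ℝ) : ℂ) * (Real.exp (-(σ * v)) : ℂ)) v else 0) :
    Summable fun n => ∫ v, ‖ψ n v‖ := by
  simp_rw [integral_norm_rieszPiece hσ ψ hψ]
  refine Summable.of_nonneg_of_le (fun n => ?_) (fun n => ?_) (hsum.div_const (σ ^ 2))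
  · split_ifs <;> positivity
  · split_ifs with h
    · exact le_of_eq (by rw [div_eq_mul_inv (‖a n‖)])
    · positivity

/-- **The Fourier transform of `Φ(v) = e^{−σv}(v A(e^v) − B(e^v))`** is `L(s)/s²`, `s = σ + 2πiξ`.
[cite: MontgomeryVaughan2007, §5.1] -/
theorem fourier_rieszPhi (ξ : ℝ) :
    𝓕 (fun v : ℝ => (Real.exp (-(σ * v)) : ℂ) * ((v : ℂ) * psum a (Real.exp v) -
        psum (fun n => a n * (Real.log n : ℂ)) (Real.exp v))) ξ =
      LSeries a (σ + (2 * π * ξ : ℝ) * I) / (σ + (2 * π * ξ : ℝ) * I) ^ 2 := by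
  set ψ : ℕ → ℝ → ℂ := fun n v => if 1 ≤ n then (Set.Ici (Real.log n)).indicator
      (fun v : ℝ => a n * ((v - Real.log n : ℝ) : ℂ) * (Real.exp (-(σ * v)) : ℂ)) v else 0 with hψ_def
  have hψ : ∀ n v, ψ n v = if 1 ≤ n then (Set.Ici (Real.log n)).indicator
      (fun v : ℝ => a n * ((v - Real.log n : ℝ) : ℂ) * (Real.exp (-(σ * v)) : ℂ)) v else 0 := fun n v => rfl
  rw [Real.fourier_real_eq]
  have h1 : (fun v : ℝ => (Real.fourierChar (-(v * ξ))) • ((Real.exp (-(σ * v)) : ℂ) *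
      ((v : ℂ) * psum a (Real.exp v) - psum (fun n => a n * (Real.log n : ℂ)) (Real.exp v)))) =
      fun v : ℝ => ∑' n, (Real.fourierChar (-(v * ξ)) : ℂ) • ψ n v := by
    funext v
    rw [rieszPhi_eq_tsum ψ hψ, Circle.smul_def, smul_eq_mul, ← tsum_mul_left]
    rfl
  rw [h1, ← integral_tsum_of_summable_integral_norm]
  · rw [LSeries, ← tsum_div_const]
    refine tsum_congr fun n => ?_
    rcases Nat.eq_zero_or_pos n with rfl | hn
    · have : ψ 0 = fun _ => 0 := by funext v; rw [hψ]; simp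
      simp [this]
    · exact fourier_rieszPiece hσ ψ hψ hn ξ
  · intro n
    have hb : MemLp (fun v : ℝ => (Real.fourierChar (-(v * ξ)) : ℂ)) ⊤ volume := by
      refine memLp_top_of_bound (by fun_prop) 1 (Filter.Eventually.of_forall fun v => ?_)
      simp
    refine ((integrable_rieszPiece hσ ψ hψ n).smul_of_top_left hb).congr
      (Filter.Eventually.of_forall fun v => ?_)
    simp only [Pi.smul_apply', smul_eq_mul]
    ring
  · refine (summable_integral_norm_rieszPiece hσ hsum ψ hψ).congr fun n => ?_
    refine integral_congr_ae (Filter.Eventually.of_forall fun v => ?_)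
    simp only [norm_smul, Circle.norm_coe, one_mul]

omit hσ hsum in
/-- Growth: under `∑_{n ≤ y} |a_n| ≤ C y^θ` (`y ≥ 1`), `‖Φ(v)‖ ≤ (2C/(σ−θ)) e^{−((σ−θ)/2) v}` for
`v ≥ 0` and `Φ(v) = 0` for `v < 0`. [folklore] -/
theorem norm_rieszPhi_le (hθ : θ < σ)
    (habs : ∀ y : ℝ, 1 ≤ y → ∑ n ∈ Finset.Icc 1 ⌊y⌋₊, ‖a n‖ ≤ C * y ^ θ) (v : ℝ) :
    ‖(Real.exp (-(σ * v)) : ℂ) * ((v : ℂ) * psum a (Real.exp v) -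
        psum (fun n => a n * (Real.log n : ℂ)) (Real.exp v))‖ ≤
      (Set.Ici (0 : ℝ)).indicator (fun v => 2 * C / (σ - θ) * Real.exp (-((σ - θ) / 2 * v))) v := by
  have hC : 0 ≤ C := by
    have := habs 1 le_rfl
    rw [Real.one_rpow, mul_one] at this
    exact le_trans (Finset.sum_nonneg fun n _ => norm_nonneg _) this
  rcases lt_or_ge v 0 with hv | hv
  · rw [Set.indicator_of_notMem (by simpa using hv), psum_of_lt_one _ (Real.exp_lt_one_iff.2 hv),
      psum_of_lt_one _ (Real.exp_lt_one_iff.2 hv)]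
    simp
  · rw [Set.indicator_of_mem (by exact hv), norm_mul, Complex.norm_real, Real.norm_of_nonneg (Real.exp_pos _).le]
    have h1 : (1 : ℝ) ≤ Real.exp v := by simpa using Real.one_le_exp hv
    have hA := habs _ h1
    rw [← Real.exp_mul] at hA
    have hR := norm_riesz_le (a := a) v
    set δ : ℝ := σ - θ with hδ
    have hδ0 : 0 < δ := by rw [hδ]; linarith
    -- `v ≤ (2/δ) e^{(δ/2) v}`
    have hv2 : v ≤ 2 / δ * Real.exp (δ / 2 * v) := by
      have h := Real.add_one_le_exp (δ / 2 * v)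
      have h2 : 2 / δ * (δ / 2 * v + 1) ≤ 2 / δ * Real.exp (δ / 2 * v) :=
        mul_le_mul_of_nonneg_left h (by positivity)
      have h3 : 2 / δ * (δ / 2 * v + 1) = v + 2 / δ := by field_simp
      have h4 : 0 < 2 / δ := by positivity
      linarith
    calc Real.exp (-(σ * v)) * ‖(v : ℂ) * psum a (Real.exp v) -
          psum (fun n => a n * (Real.log n : ℂ)) (Real.exp v)‖
        ≤ Real.exp (-(σ * v)) * (v * (C * Real.exp (v * θ))) := by
          refine mul_le_mul_of_nonneg_left (hR.trans ?_) (Real.exp_pos _).le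
          exact mul_le_mul_of_nonneg_left hA hv
      _ = C * (v * Real.exp (-(δ * v))) := by
          rw [hδ, show -((σ - θ) * v) = -(σ * v) + v * θ by ring, Real.exp_add]; ring
      _ ≤ C * (2 / δ * Real.exp (δ / 2 * v) * Real.exp (-(δ * v))) := by
          gcongr
      _ = 2 * C / δ * Real.exp (-(δ / 2 * v)) := by
          rw [mul_assoc (2 / δ), ← Real.exp_add, show δ / 2 * v + -(δ * v) = -(δ / 2 * v) by ring]
          ring

omit hσ hsum in
/-- `Φ` is measurable. [folklore] -/
theorem measurable_rieszPhi :
    Measurable fun v : ℝ => (Real.exp (-(σ * v)) : ℂ) * ((v : ℂ) * psum a (Real.exp v) -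
        psum (fun n => a n * (Real.log n : ℂ)) (Real.exp v)) := by
  refine (Complex.measurable_ofReal.comp (by fun_prop)).mul ?_
  refine Measurable.sub ((Complex.measurable_ofReal).mul ((measurable_psum a).comp Real.measurable_exp)) ?_
  exact (measurable_psum _).comp Real.measurable_exp

omit hσ hsum in
/-- `Φ ∈ L¹` under the absolute growth bound. [folklore] -/
theorem integrable_rieszPhi (hθ : θ < σ)
    (habs : ∀ y : ℝ, 1 ≤ y → ∑ n ∈ Finset.Icc 1 ⌊y⌋₊, ‖a n‖ ≤ C * y ^ θ) :
    Integrable fun v : ℝ => (Real.exp (-(σ * v)) : ℂ) * ((v : ℂ) * psum a (Real.exp v) -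
        psum (fun n => a n * (Real.log n : ℂ)) (Real.exp v)) := by
  have hg : Integrable ((Set.Ici (0 : ℝ)).indicator (fun v => 2 * C / (σ - θ) * Real.exp (-((σ - θ) / 2 * v)))) := by
    rw [integrable_indicator_iff measurableSet_Ici, integrableOn_Ici_iff_integrableOn_Ioi]
    have h0 : IntegrableOn (fun v : ℝ => 2 * C / (σ - θ) * Real.exp (-((σ - θ) / 2) * v)) (Set.Ioi 0) :=
      (exp_neg_integrableOn_Ioi 0 (b := (σ - θ) / 2) (by linarith)).const_mul _
    refine IntegrableOn.congr_fun h0 (fun v _ => ?_) measurableSet_Ioi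
    show 2 * C / (σ - θ) * Real.exp (-((σ - θ) / 2) * v) = 2 * C / (σ - θ) * Real.exp (-((σ - θ) / 2 * v))
    rw [neg_mul]
  exact hg.mono' measurable_rieszPhi.aestronglyMeasurable
    (Filter.Eventually.of_forall (norm_rieszPhi_le hθ habs))

omit hσ hsum in
/-- `Φ ∈ L²` (bounded and integrable). [folklore] -/
theorem memLp_two_rieszPhi (hθ : θ < σ)
    (habs : ∀ y : ℝ, 1 ≤ y → ∑ n ∈ Finset.Icc 1 ⌊y⌋₊, ‖a n‖ ≤ C * y ^ θ) :
    MemLp (fun v : ℝ => (Real.exp (-(σ * v)) : ℂ) * ((v : ℂ) * psum a (Real.exp v) -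
        psum (fun n => a n * (Real.log n : ℂ)) (Real.exp v))) 2 := by
  have hC : 0 ≤ C := by
    have := habs 1 le_rfl
    rw [Real.one_rpow, mul_one] at this
    exact le_trans (Finset.sum_nonneg fun n _ => norm_nonneg _) this
  refine Literature.NumberTheory.LFunctions.WindowPlancherel.memLp_two_of_norm_le
    (integrable_rieszPhi hθ habs) (M := 2 * C / (σ - θ)) fun v => ?_
  refine (norm_rieszPhi_le hθ habs v).trans ?_
  rcases lt_or_ge v 0 with hv | hv
  · rw [Set.indicator_of_notMem (by simpa using hv)]
    have : 0 < σ - θ := by linarith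
    positivity
  · rw [Set.indicator_of_mem (by exact hv)]
    have hδ : 0 < σ - θ := by linarith
    have h1 : Real.exp (-((σ - θ) / 2 * v)) ≤ 1 := Real.exp_le_one_iff.2 (by nlinarith)
    have h2 : 0 ≤ 2 * C / (σ - θ) := by positivity
    nlinarith

/-- **Mellin–Plancherel for logarithmic Riesz means**: for `ℓ¹`-weighted coefficients
(`∑ |a_n| n^{−σ} < ∞`, `σ > 0`) with `∑_{n ≤ y} |a_n| ≤ C y^θ` (`y ≥ 1`) for some `θ < σ`,
`∫ |v A(e^v) − B(e^v)|² e^{−2σv} dv = (1/2π) ∫ |L(σ+iy)|² / |σ+iy|⁴ dy`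
(`A = ∑_{n ≤ ·} a_n`, `B = ∑_{n ≤ ·} a_n log n`, so `v A(e^v) − B(e^v) = ∑_{n ≤ e^v} a_n (v − log n)`).
[cite: MontgomeryVaughan2007, §5.1 (5.25)] -/
theorem integral_norm_sq_riesz_exp (hθ : θ < σ)
    (habs : ∀ y : ℝ, 1 ≤ y → ∑ n ∈ Finset.Icc 1 ⌊y⌋₊, ‖a n‖ ≤ C * y ^ θ) :
    ∫ v : ℝ, ‖(v : ℂ) * psum a (Real.exp v) - psum (fun n => a n * (Real.log n : ℂ)) (Real.exp v)‖ ^ 2 *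
        Real.exp (-(2 * σ * v)) =
      (1 / (2 * π)) * ∫ y : ℝ, ‖LSeries a (σ + y * I)‖ ^ 2 / ‖(σ : ℂ) + y * I‖ ^ 4 := by
  set Φ : ℝ → ℂ := fun v : ℝ => (Real.exp (-(σ * v)) : ℂ) * ((v : ℂ) * psum a (Real.exp v) -
        psum (fun n => a n * (Real.log n : ℂ)) (Real.exp v)) with hΦ
  have hP := Literature.Analysis.FunctionSpaces.integral_norm_sq_fourierIntegral_eq
    (integrable_rieszPhi hθ habs) (memLp_two_rieszPhi hθ habs)
  have hR : ∫ v : ℝ, ‖Φ v‖ ^ 2 = ∫ v : ℝ, ‖(v : ℂ) * psum a (Real.exp v) -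
      psum (fun n => a n * (Real.log n : ℂ)) (Real.exp v)‖ ^ 2 * Real.exp (-(2 * σ * v)) := by
    refine integral_congr_ae (Filter.Eventually.of_forall fun v => ?_)
    simp only [hΦ, norm_mul, Complex.norm_real, Real.norm_of_nonneg (Real.exp_pos _).le]
    rw [mul_pow, ← Real.exp_nat_mul]
    ring_nf
  set G : ℝ → ℝ := fun y => ‖LSeries a (σ + y * I)‖ ^ 2 / ‖(σ : ℂ) + y * I‖ ^ 4 with hG
  have hL : ∫ ξ : ℝ, ‖𝓕 Φ ξ‖ ^ 2 = ∫ ξ : ℝ, G ((2 * π) * ξ) := by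
    refine integral_congr_ae (Filter.Eventually.of_forall fun ξ => ?_)
    simp only [hG, hΦ]
    rw [fourier_rieszPhi hσ hsum, norm_div, div_pow, norm_pow, ← pow_mul]
  have h2π : |(2 * π)⁻¹| = 1 / (2 * π) := by rw [abs_of_pos (by positivity), one_div]
  rw [← hR, ← hP, hL, Measure.integral_comp_mul_left G, h2π, smul_eq_mul]

end Literature.NumberTheory.LFunctions.MellinPlancherel
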